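import Literature.NumberTheory.EllipticCurves.CanonicalPAdicHeightKDenominatorProofs
import Literature.NumberTheory.EllipticCurves.FormalGroupLawPadicProofs
import Literature.NumberTheory.EllipticCurves.CanonicalPAdicHeightAdmissibleKProofs
import HarnessLib

/-!
# The canonical `p`-adic height over a number field `K`: the theta relation at `K`-points, the
# parallelogram law of the sigma formula, and `exists_isCanonicalK` from the two Mazur–Tate facts

Trunk T-NT-EC (Literature/NumberTheory/EllipticCurves); third proof file behind the named fact
`WeierstrassCurve.exists_isCanonicalK` (`CanonicalPAdicHeight.lean`: for `E/ℚ` with `W`, `W ⊗ K`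
globally minimal and `p ≥ 5` good ordinary, TOTALLY SPLIT in `K`, there is a symmetric bilinear
torsion-vanishing `PAdicHeightDataK W p K` whose quadratic form on admissible points is
`ĥ_{p,K}(P) = log_p N𝔡(x(P)) - 2 Σ_ι log_p σ_p(z(ιP))`, Balakrishnan–Çiperiani–Stein 2015 §4.1
eq. (4.1) = `-2p ×` Mazur–Stein–Tate 2006 §2.8). With the two sibling files it PROVES

  `exists_isCanonicalK ⟸ mazur_tate_sigma_existsUnique ∧ padicSigma_theta_formal`
  (`exists_isCanonicalK_of_MT_theta`),

i.e. the `K`-version rests on exactly the two named facts behind the `ℚ`-version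
(`exists_isCanonical_of_MT_theta`, `FormalGroupLawPadicProofs.lean`): the existence of the
Mazur–Tate pair (MST 2006 Thm. 1.3) and the formal theta identity of `σ` (Mazur–Tate 1991
Thm. 3.1 / Blakestad–Grant 2023 Prop. 14). Nothing is asserted here. Contents:

* `padicEval_theta_of_thetaLHS_eq`, `padicSigmaEval_theta_padic` — the theta relation
  `σ_p(z(P+Q))σ_p(z(P-Q)) = (x(Q) - x(P))σ_p(z P)²σ_p(z Q)²` at `ℚ_p`-POINTS of `E₁(ℚ_p)` (the
  tree's `padicSigma_theta_of_formal` did rational points), from the formal identity evaluated at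
  `(z P, z Q)` and the tree's theorem `formalGroupLaw_padicEval_holds` (AEC IV.1–2, VII.2.2);
* `padicSigmaEval_theta_emb` — the same at `K`-points under an embedding `ι : K → ℚ_p`
  (Mathlib's homomorphism `Point.map ι : E(K) → E(ℚ_p)`): the local identity at the places above
  `p` ("property IV of `σ`", MST 2006 §2.3, §2.7);
* `canonicalPAdicHeightK_parallelogram_of_MT_theta` — **the parallelogram law of `ĥ_{p,K}` on
  generic admissible pairs**: `N𝔡₃N𝔡₄ = N𝔡₁²N𝔡₂²N(δ)²` (finite places,
  `absNorm_denominatorIdeal_parallelogram`), `σ₃(ι)σ₄(ι) = -ι(δ)σ₁(ι)²σ₂(ι)²` (places above `p`)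
  and the product formula at the split prime `∏_ι ι(δ) = N(δ)` (`prod_embeddings_eq_norm`), with
  `log_p` multiplicative (`padicLog_mul_holds`) and `log_p(-1) = 0`;
* `exists_isCanonicalK_of_MT_theta`, `existsUnique_isCanonicalK_of_MT_theta` — the assembly, as
  for `ℚ` (`CanonicalPAdicHeightProofs.lean`): the admissible locus with `O` is a torsion-free
  subgroup (`CanonicalPAdicHeightKLocusProofs.lean`; an embedding `K → ℚ_p` exists because there
  are `[K:ℚ] ≥ 1` of them), `parallelogram_of_generic`, `exists_pairing_of_parallelogram`
  (Jordan–von Neumann + `ℚ_p` injective); uniqueness by the tree's theorem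
  `exists_admissibleK_nsmul_holds` and `PAdicHeightDataK.isCanonical_unique`.

## Sources

* B. Mazur, W. Stein, J. Tate, *Computation of `p`-adic heights and log convergence*, Doc. Math.
  Extra Vol. Coates (2006) (held; read PDF pp. 2–3, 7–10): §1 eq. (1.1), Thm. 1.3; §2.3
  (`σ_v : E₁(K_v) → K_v^*`), §2.6 (`(α, β) = ½ Σ_v ι_v((α, β)_v²)`), §2.7 ("`h_ρ` is quadratic
  because of property IV of `σ` in [MT91]"), §2.8 (`ρ^K_cycl = ρ^ℚ_cycl ∘ N_{K/ℚ}`; formula for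
  `h_p(P)` over `K`).
* B. Mazur, J. Tate, *The `p`-adic sigma function*, Duke Math. J. 62 (1991), Thm. 3.1 (as cited
  in MST 2006 §2.7 and Blakestad–Grant 2023 §3); C. Blakestad, D. Grant, J. Number Theory 249
  (2023), Prop. 14, Thm. 15.
* J. Balakrishnan, M. Çiperiani, W. Stein, *`p`-adic heights of Heegner points and `Λ`-adic
  regulators*, Math. Comp. 84 (2015), §4.1 eq. (4.1) (not held; WANTED
  doi:10.1090/s0025-5718-2014-02876-7; statement as transcribed in `CanonicalPAdicHeight.lean`).
* B. Perrin-Riou, Invent. Math. 89 (1987), §1.2 (the height over `K` imaginary quadratic, `p`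
  split).

## Design notes

* The theta relation at points holds without the hypothesis `x(P) ≠ x(Q)` (both sides vanish or
  agree in the degenerate cases, the chord-tangent case analysis being inside
  `formalGroupLaw_padicEval_holds`); the parallelogram step uses it only for `x(P) ≠ x(Q)`.
* Trust base of `exists_isCanonicalK_of_MT_theta`: `mazur_tate_sigma_existsUnique`,
  `padicSigma_theta_formal` (both `def … : Prop` in the tree, hypotheses here), and the axioms
  `propext`, `Classical.choice`, `Quot.sound`.
-/

noncomputable section

open scoped Classical NNReal
open IsDedekindDomain NumberField

/-! ### The theta relation of `σ_p` at `ℚ_p`-points and at `K`-points of the kernel of reduction -/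

namespace WeierstrassCurve

open Literature.NumberTheory.EllipticCurves

/-- **The theta relation at `ℚ_p`-points from the formal theta identity** (core computation): for
`V/ℚ_p` elliptic with `p`-integral coefficients, an integral series `σ` satisfying the formal
identity `thetaLHS σ = thetaRHS σ` (`σ(F(u,v))σ(F(u,i(v)))u²v² = (u²X(v) - v²X(u))σ(u)²σ(v)²`),
and `P = (x₁, y₁)`, `Q = (x₂, y₂) ∈ E₁(ℚ_p)`:
`σ̂(z(P+Q)) σ̂(z(P-Q)) = (x₂ - x₁) σ̂(z(P))² σ̂(z(Q))²` — evaluate at `(z(P), z(Q))`, read the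
formal group law as the chord-tangent law (`formalGroupLaw_padicEval_holds`), `î(z Q) = z(-Q)`,
`X̂(z P) = x(P) z(P)²`, and cancel `z(P)²z(Q)²`. [Blakestad–Grant 2023, Thm. 15 (specialisation
of Prop. 14 at points); Mazur–Tate 1991, Thm. 3.1] [cite: BlakestadGrant2023, Thm. 15] -/
theorem padicEval_theta_of_thetaLHS_eq {p : ℕ} [Fact p.Prime] (V : WeierstrassCurve ℚ_[p])
    [V.IsElliptic] [V.IsIntegral ℤ_[p]] {σ : PowerSeries ℚ_[p]} (hσ : IsPadicInt σ)
    (hΘ : V.thetaLHS σ = V.thetaRHS σ) {x₁ y₁ x₂ y₂ : ℚ_[p]}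
    (h₁ : V.toAffine.Nonsingular x₁ y₁) (h₂ : V.toAffine.Nonsingular x₂ y₂) (hx₁ : 1 < ‖x₁‖)
    (hx₂ : 1 < ‖x₂‖) :
    padicEval σ (V.formalParameter (.some x₁ y₁ h₁ + .some x₂ y₂ h₂)) *
        padicEval σ (V.formalParameter (.some x₁ y₁ h₁ - .some x₂ y₂ h₂)) =
      (x₂ - x₁) * padicEval σ (-x₁ / y₁) ^ 2 * padicEval σ (-x₂ / y₂) ^ 2 := by
  have hFadd := formalGroupLaw_padicEval_holds p V
  -- the points
  set P : V.toAffine.Point := .some x₁ y₁ h₁ with hPdef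
  set Q : V.toAffine.Point := .some x₂ y₂ h₂ with hQdef
  have hnQ : -Q = .some x₂ (V.toAffine.negY x₂ y₂) ((Affine.nonsingular_neg ..).mpr h₂) := by
    rw [hQdef, Affine.Point.neg_some]
  have hkP : V.IsInReductionKernel P := hx₁
  have hkQ : V.IsInReductionKernel Q := hx₂
  have hknQ : V.IsInReductionKernel (-Q) := by rw [hnQ]; exact hx₂
  -- parameters
  obtain ⟨-, hu0, hu1, -, -⟩ := V.param_facts h₁.1 hx₁
  obtain ⟨-, hv0, hv1, -, -⟩ := V.param_facts h₂.1 hx₂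
  set u : ℚ_[p] := -x₁ / y₁ with hudef
  set v : ℚ_[p] := -x₂ / y₂ with hvdef
  have hzP : V.formalParameter P = u := rfl
  have hzQ : V.formalParameter Q = v := rfl
  have hznQ : V.formalParameter (-Q) = padicEval V.formalNeg v := by
    rw [hnQ, V.padicEval_formalNeg_eq h₂.1 hx₂]; rfl
  -- the formal group law at `(P, Q)` and `(P, -Q)`
  have hadd : padicEval₂ V.formalGroupLaw u v = V.formalParameter (P + Q) := by
    rw [← hzP, ← hzQ]; exact hFadd _ _ hkP hkQ
  have hsub : padicEval₂ V.formalGroupLaw u (padicEval V.formalNeg v) =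
      V.formalParameter (P - Q) := by
    rw [← hzP, ← hznQ, sub_eq_add_neg]; exact hFadd _ _ hkP hknQ
  -- the dictionary for `X = z²x`
  have hXu : padicEval V.formalXMulSq u = x₁ * u ^ 2 := V.padicEval_formalXMulSq_eq h₁.1 hx₁
  have hXv : padicEval V.formalXMulSq v = x₂ * v ^ 2 := V.padicEval_formalXMulSq_eq h₂.1 hx₂
  -- evaluate the formal identity at `(u, v)`
  have key := congrArg (fun G => padicEval₂ G u v) hΘ
  rw [padicEval₂_thetaLHS hσ hu1 hv1, padicEval₂_thetaRHS hσ hu1 hv1, hadd, hsub, hXu,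
    hXv] at key
  have huv : u ^ 2 * v ^ 2 ≠ 0 := mul_ne_zero (pow_ne_zero 2 hu0) (pow_ne_zero 2 hv0)
  apply mul_right_cancel₀ huv
  linear_combination key

/-- **The Mazur–Tate theta relation at `ℚ_p`-points of `E₁(ℚ_p)`**, from the existence of the
Mazur–Tate pair (`mazur_tate_sigma_existsUnique`, MST 2006 Thm. 1.3) and the formal theta
identity (`padicSigma_theta_formal`, Mazur–Tate 1991 Thm. 3.1 / Blakestad–Grant 2023 Prop. 14):
for `W/ℚ` globally minimal, `p ≥ 5` good ordinary, and `P = (x₁, y₁)`, `Q = (x₂, y₂) ∈ E(ℚ_p)`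
with `‖x₁‖, ‖x₂‖ > 1`: `σ_p(z(P+Q)) σ_p(z(P-Q)) = (x₂ - x₁) σ_p(z(P))² σ_p(z(Q))²`
(`z = -x/y`). The `ℚ_p`-point form of `padicSigma_theta_of_formal` (there for rational points).
[Mazur–Tate 1991, Thm. 3.1; Blakestad–Grant 2023, Prop. 14, Thm. 15; Mazur–Stein–Tate 2006,
§2.3, §2.7] [cite: BlakestadGrant2023, Thm. 15] -/
theorem padicSigmaEval_theta_padic (hMT : mazur_tate_sigma_existsUnique)
    (hθ : padicSigma_theta_formal) (W : WeierstrassCurve ℚ) [W.IsElliptic] [W.IsGloballyMinimal]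
    (p : ℕ) [Fact p.Prime] (hp : 5 ≤ p) (hgood : W.HasGoodReductionAtPrime p)
    (hord : ¬ (p : ℤ) ∣ W.frobeniusTrace p) {x₁ y₁ x₂ y₂ : ℚ_[p]}
    (h₁ : (W.baseChange ℚ_[p]).toAffine.Nonsingular x₁ y₁)
    (h₂ : (W.baseChange ℚ_[p]).toAffine.Nonsingular x₂ y₂) (hx₁ : 1 < ‖x₁‖) (hx₂ : 1 < ‖x₂‖) :
    W.padicSigmaEval p ((W.baseChange ℚ_[p]).formalParameter (.some x₁ y₁ h₁ + .some x₂ y₂ h₂)) *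
        W.padicSigmaEval p
          ((W.baseChange ℚ_[p]).formalParameter (.some x₁ y₁ h₁ - .some x₂ y₂ h₂)) =
      (x₂ - x₁) * W.padicSigmaEval p (-x₁ / y₁) ^ 2 * W.padicSigmaEval p (-x₂ / y₂) ^ 2 := by
  haveI : (W.baseChange ℚ_[p]).IsElliptic := by rw [baseChange]; infer_instance
  -- the Mazur–Tate pair exists, so `padicSigma` is one, and the formal identity holds for it
  obtain ⟨⟨σ₀, c₀⟩, hσ₀, -⟩ := hMT W p hp hgood hord
  have hpair := (W.baseChange ℚ_[p]).isMazurTateSigmaPair_padicSigma ⟨σ₀, c₀, hσ₀⟩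
  have hσint : IsPadicInt (W.baseChange ℚ_[p]).padicSigma :=
    isPadicInt_iff_coeff.mpr hpair.norm_coeff_le
  exact padicEval_theta_of_thetaLHS_eq (W.baseChange ℚ_[p]) hσint
    (hθ W p hp hgood hord _ _ hpair) h₁ h₂ hx₁ hx₂

/-- **The theta relation at `K`-points under an embedding `ι : K → ℚ_p`.** For `W/ℚ` globally
minimal, `p ≥ 5` good ordinary, a number field `K`, `ι : K → ℚ_p`, and `P = (x₁, y₁)`,
`Q = (x₂, y₂) ∈ E(K)` with `‖ι x₁‖, ‖ι x₂‖ > 1`, `P + Q = (x₃, y₃)`, `P - Q = (x₄, y₄)`: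
`σ_p(z(ιP₃)) σ_p(z(ιP₄)) = (ι x₂ - ι x₁) σ_p(z(ιP))² σ_p(z(ιQ))²`, `z(ιR) = -ι x(R)/ι y(R)` — the
`ℚ_p`-point relation transported along Mathlib's homomorphism `Point.map ι : E(K) → E(ℚ_p)`.
This is the local identity at the places above `p` behind "`h_ρ` is quadratic because of property
IV of `σ`" (MST 2006, §2.7). [Mazur–Stein–Tate 2006, §2.3, §2.7; Mazur–Tate 1991, Thm. 3.1]
[cite: MazurSteinTate2006, §2.7] -/
theorem padicSigmaEval_theta_emb (hMT : mazur_tate_sigma_existsUnique)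
    (hθ : padicSigma_theta_formal) (W : WeierstrassCurve ℚ) [W.IsElliptic] [W.IsGloballyMinimal]
    (K : Type) [Field K] [NumberField K] (p : ℕ) [Fact p.Prime] (hp : 5 ≤ p)
    (hgood : W.HasGoodReductionAtPrime p) (hord : ¬ (p : ℤ) ∣ W.frobeniusTrace p)
    (ι : K →+* ℚ_[p]) {x₁ y₁ x₂ y₂ x₃ y₃ x₄ y₄ : K}
    (h₁ : (W.baseChange K).toAffine.Nonsingular x₁ y₁)
    (h₂ : (W.baseChange K).toAffine.Nonsingular x₂ y₂)
    (h₃ : (W.baseChange K).toAffine.Nonsingular x₃ y₃)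
    (h₄ : (W.baseChange K).toAffine.Nonsingular x₄ y₄)
    (hS : (.some x₁ y₁ h₁ : (W.baseChange K).toAffine.Point) + .some x₂ y₂ h₂ = .some x₃ y₃ h₃)
    (hD : (.some x₁ y₁ h₁ : (W.baseChange K).toAffine.Point) - .some x₂ y₂ h₂ = .some x₄ y₄ h₄)
    (hx₁ : 1 < ‖ι x₁‖) (hx₂ : 1 < ‖ι x₂‖) :
    W.padicSigmaEval p (-ι x₃ / ι y₃) * W.padicSigmaEval p (-ι x₄ / ι y₄) =
      (ι x₂ - ι x₁) * W.padicSigmaEval p (-ι x₁ / ι y₁) ^ 2 *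
        W.padicSigmaEval p (-ι x₂ / ι y₂) ^ 2 := by
  set f : (W.baseChange K).toAffine.Point →+ (W.baseChange ℚ_[p]).toAffine.Point :=
    Affine.Point.map (W' := W.toAffine) (S := ℚ) ι.toRatAlgHom with hf
  have hh : ∀ {x y : K}, (W.baseChange K).toAffine.Nonsingular x y →
      (W.baseChange ℚ_[p]).toAffine.Nonsingular (ι x) (ι y) := fun {x y} h =>
    (Affine.baseChange_nonsingular (W := W.toAffine) (f := ι.toRatAlgHom)
      ι.toRatAlgHom.toRingHom.injective x y).mpr h
  have hfP : ∀ {x y : K} (h : (W.baseChange K).toAffine.Nonsingular x y),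
      f (.some x y h) = .some (ι x) (ι y) (hh h) := fun h => rfl
  have key := W.padicSigmaEval_theta_padic hMT hθ p hp hgood hord (hh h₁) (hh h₂) hx₁ hx₂
  rw [← hfP h₁, ← hfP h₂, ← map_add, ← map_sub, hS, hD, hfP h₃, hfP h₄, formalParameter_some,
    formalParameter_some] at key
  exact key

end WeierstrassCurve

/-! ### The parallelogram law of the sigma formula over `K`, and the existence of the canonical
`K`-datum -/

namespace WeierstrassCurve

open Literature.NumberTheory.EllipticCurves

/-- The sigma formula over `K`, unfolded at an affine point. [Balakrishnan–Çiperiani–Stein 2015,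
§4.1 eq. (4.1)] [folklore] -/
theorem canonicalPAdicHeightK_some (W : WeierstrassCurve ℚ) (p : ℕ) [Fact p.Prime] (K : Type)
    [Field K] [NumberField K] {x y : K} (h : (W.baseChange K).toAffine.Nonsingular x y) :
    W.canonicalPAdicHeightK p K (.some x y h) =
      padicLog p ((Ideal.absNorm (denominatorIdeal K x) : ℚ) : ℚ_[p]) -
        2 * ∑ ι : K →+* ℚ_[p], padicLog p (W.padicSigmaEval p (-(ι x) / ι y)) :=
  rfl

/-- **`σ_p(z(ιP)) ≠ 0` for `P ∈ E(K) ∩ E₁` at `ι`, `p` odd**: `z(ιP) = -ι x/ι y` lies in the punctured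
open unit disc. [Mazur–Stein–Tate 2006, §2.3 ("`σ_v` as a mapping from `E₁(K_v)` to `K_v^*`")]
[folklore] -/
theorem padicSigmaEval_emb_ne_zero (W : WeierstrassCurve ℚ) [W.IsIntegral ℤ] (K : Type) [Field K]
    [NumberField K] (p : ℕ) [Fact p.Prime] (hp : p ≠ 2) (ι : K →+* ℚ_[p]) {x y : K}
    (h : (W.baseChange K).toAffine.Nonsingular x y) (hx : 1 < ‖ι x‖) :
    W.padicSigmaEval p (-ι x / ι y) ≠ 0 := by
  obtain ⟨hy, hdisc⟩ := inSigmaDisc_of_one_lt_norm_emb (W := W) hp ι h hx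
  have hx0 : ι x ≠ 0 := by
    rintro h0; rw [h0, norm_zero] at hx; exact not_lt.mpr zero_le_one hx
  have hz0 : -ι x / ι y ≠ 0 := div_ne_zero (neg_ne_zero.mpr hx0) hy
  have hz1 : ‖-ι x / ι y‖ < 1 := by
    refine lt_trans hdisc ?_
    have hp1 : (1 : ℝ) < p := by exact_mod_cast (Fact.out : p.Prime).one_lt
    calc (p : ℝ) ^ (-(1 / ((p : ℝ) - 1))) < (p : ℝ) ^ (0 : ℝ) := by
          rw [Real.rpow_lt_rpow_left_iff hp1, neg_lt_zero]
          exact div_pos one_pos (by linarith)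
      _ = 1 := Real.rpow_zero _
  exact W.padicSigmaEval_ne_zero p hz0 hz1

/-- **The sigma formula over `K` satisfies the parallelogram law on generic admissible pairs**
(`p` totally split in `K`), from the existence of the Mazur–Tate pair
(`mazur_tate_sigma_existsUnique`, MST 2006 Thm. 1.3) and the formal theta identity
(`padicSigma_theta_formal`, MT 1991 Thm. 3.1 / Blakestad–Grant 2023 Prop. 14) — the printed
argument of MST 2006 §2.6–2.8 ("`h_ρ` is quadratic because of property IV of `σ` in [MT91]"):
with `𝔡ᵢ = 𝔡(x(Pᵢ))`, `σᵢ(ι) = σ_p(z(ιPᵢ))` (`P₃ = P + Q`, `P₄ = P - Q`), `δ = x(P) - x(Q)`: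
`N𝔡₃N𝔡₄ = N𝔡₁²N𝔡₂²N(δ)²` (Néron's local laws at the finite places of `K`,
`absNorm_denominatorIdeal_parallelogram`), `σ₃(ι)σ₄(ι) = -ι(δ)σ₁(ι)²σ₂(ι)²` at each embedding
(`padicSigmaEval_theta_emb`) and `∏_ι ι(δ) = N(δ)` (`prod_embeddings_eq_norm`), so that
`ĥ(P+Q) + ĥ(P-Q) = log_p(N𝔡₃N𝔡₄) - 2Σ_ι log_p(σ₃σ₄) = 2ĥ(P) + 2ĥ(Q)` (`log_p(-1) = 0`).
[Mazur–Stein–Tate 2006, §2.6–2.8; Balakrishnan–Çiperiani–Stein 2015, §4.1 eq. (4.1)]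
[cite: MazurSteinTate2006, §2.8] -/
theorem canonicalPAdicHeightK_parallelogram_of_MT_theta (hMT : mazur_tate_sigma_existsUnique)
    (hθ : padicSigma_theta_formal) (W : WeierstrassCurve ℚ) [W.IsElliptic] [W.IsGloballyMinimal]
    (K : Type) [Field K] [NumberField K] (p : ℕ) [Fact p.Prime] (hp : 5 ≤ p)
    (hgood : W.HasGoodReductionAtPrime p) (hord : ¬ (p : ℤ) ∣ W.frobeniusTrace p)
    (hsplit : Fintype.card (K →+* ℚ_[p]) = Module.finrank ℚ K)
    (P Q : (W.baseChange K).toAffine.Point) (hP : W.SatisfiesLocalConditionsK p K P)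
    (hQ : W.SatisfiesLocalConditionsK p K Q) (hsub : P - Q ≠ 0) (hadd : P + Q ≠ 0) :
    W.canonicalPAdicHeightK p K (P + Q) + W.canonicalPAdicHeightK p K (P - Q) =
      2 * W.canonicalPAdicHeightK p K P + 2 * W.canonicalPAdicHeightK p K Q := by
  have hp2 : p ≠ 2 := by omega
  have hmul : padicLog_mul p := padicLog_mul_holds p
  -- the subgroup: `P ± Q` again satisfy the local conditions
  obtain ⟨H, hH⟩ := exists_addSubgroup_coe_eq_localConditionsLocusK W K hp2
  have hmem : ∀ R, R ∈ H ↔ R = 0 ∨ W.SatisfiesLocalConditionsK p K R := fun R => by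
    rw [← SetLike.mem_coe, hH]; rfl
  have hPH : P ∈ H := (hmem P).mpr (Or.inr hP)
  have hQH : Q ∈ H := (hmem Q).mpr (Or.inr hQ)
  have hS' : W.SatisfiesLocalConditionsK p K (P + Q) :=
    ((hmem _).mp (H.add_mem hPH hQH)).resolve_left hadd
  have hD' : W.SatisfiesLocalConditionsK p K (P - Q) :=
    ((hmem _).mp (H.sub_mem hPH hQH)).resolve_left hsub
  -- coordinates of the four points
  rcases P with _ | ⟨x₁, y₁, h₁⟩
  · exact hP.elim
  rcases Q with _ | ⟨x₂, y₂, h₂⟩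
  · exact hQ.elim
  have hx : x₁ ≠ x₂ := X_ne_of_sub_ne_zero_of_add_ne_zero h₁ h₂ hsub hadd
  rcases hS : (.some x₁ y₁ h₁ : (W.baseChange K).toAffine.Point) + .some x₂ y₂ h₂ with _ | ⟨x₃, y₃, h₃⟩
  · exact (hadd hS).elim
  rcases hD : (.some x₁ y₁ h₁ : (W.baseChange K).toAffine.Point) - .some x₂ y₂ h₂ with _ | ⟨x₄, y₄, h₄⟩
  · exact (hsub hD).elim
  rw [hS] at hS'
  rw [hD] at hD'
  obtain ⟨hι₁, hns₁⟩ := hP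
  obtain ⟨hι₂, hns₂⟩ := hQ
  obtain ⟨hι₃, -⟩ := hS'
  obtain ⟨hι₄, -⟩ := hD'
  -- the denominator identity and its logarithm
  have hden := absNorm_denominatorIdeal_parallelogram h₁ h₂ h₃ h₄ hx hS hD fun v => ⟨hns₁ v, hns₂ v⟩
  have hN0 : ∀ x : K, ((Ideal.absNorm (denominatorIdeal K x) : ℚ) : ℚ_[p]) ≠ 0 := fun x => by
    exact_mod_cast Ideal.absNorm_eq_zero_iff.not.mpr (denominatorIdeal_ne_bot K x)
  have hδ : ((Algebra.norm ℚ (x₁ - x₂) : ℚ) : ℚ_[p]) ≠ 0 := by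
    exact_mod_cast Algebra.norm_ne_zero_iff.mpr (sub_ne_zero.mpr hx)
  have hdenp : ((Ideal.absNorm (denominatorIdeal K x₃) : ℚ) : ℚ_[p]) *
      ((Ideal.absNorm (denominatorIdeal K x₄) : ℚ) : ℚ_[p]) =
        ((Ideal.absNorm (denominatorIdeal K x₁) : ℚ) : ℚ_[p]) ^ 2 *
          ((Ideal.absNorm (denominatorIdeal K x₂) : ℚ) : ℚ_[p]) ^ 2 *
          ((Algebra.norm ℚ (x₁ - x₂) : ℚ) : ℚ_[p]) ^ 2 := by
    have := congrArg (fun q : ℚ => (q : ℚ_[p])) hden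
    push_cast at this ⊢
    exact this
  have hlogd : padicLog p ((Ideal.absNorm (denominatorIdeal K x₃) : ℚ) : ℚ_[p]) +
      padicLog p ((Ideal.absNorm (denominatorIdeal K x₄) : ℚ) : ℚ_[p]) =
        2 * padicLog p ((Ideal.absNorm (denominatorIdeal K x₁) : ℚ) : ℚ_[p]) +
          2 * padicLog p ((Ideal.absNorm (denominatorIdeal K x₂) : ℚ) : ℚ_[p]) +
          2 * padicLog p ((Algebra.norm ℚ (x₁ - x₂) : ℚ) : ℚ_[p]) := by
    rw [← hmul (hN0 x₃) (hN0 x₄), hdenp,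
      hmul (mul_ne_zero (pow_ne_zero 2 (hN0 x₁)) (pow_ne_zero 2 (hN0 x₂))) (pow_ne_zero 2 hδ),
      hmul (pow_ne_zero 2 (hN0 x₁)) (pow_ne_zero 2 (hN0 x₂)), padicLog_sq (hN0 x₁),
      padicLog_sq (hN0 x₂), padicLog_sq hδ]
  -- the theta relation at each embedding and its logarithm
  have hlogσ : ∀ ι : K →+* ℚ_[p],
      padicLog p (W.padicSigmaEval p (-ι x₃ / ι y₃)) + padicLog p (W.padicSigmaEval p (-ι x₄ / ι y₄)) =
        padicLog p (ι (x₁ - x₂)) + 2 * padicLog p (W.padicSigmaEval p (-ι x₁ / ι y₁)) +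
          2 * padicLog p (W.padicSigmaEval p (-ι x₂ / ι y₂)) := fun ι => by
    have hθ' := W.padicSigmaEval_theta_emb hMT hθ K p hp hgood hord ι h₁ h₂ h₃ h₄ hS hD (hι₁ ι).1
      (hι₂ ι).1
    have hσ₁ := W.padicSigmaEval_emb_ne_zero K p hp2 ι h₁ (hι₁ ι).1
    have hσ₂ := W.padicSigmaEval_emb_ne_zero K p hp2 ι h₂ (hι₂ ι).1
    have hσ₃ := W.padicSigmaEval_emb_ne_zero K p hp2 ι h₃ (hι₃ ι).1
    have hσ₄ := W.padicSigmaEval_emb_ne_zero K p hp2 ι h₄ (hι₄ ι).1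
    have hδ' : ι x₂ - ι x₁ ≠ 0 := sub_ne_zero.mpr fun h => hx (ι.injective h).symm
    rw [← hmul hσ₃ hσ₄, hθ', hmul (mul_ne_zero hδ' (pow_ne_zero 2 hσ₁)) (pow_ne_zero 2 hσ₂),
      hmul hδ' (pow_ne_zero 2 hσ₁), padicLog_sq hσ₁, padicLog_sq hσ₂, ← neg_sub, padicLog_neg
        (sub_ne_zero.mpr fun h => hx (ι.injective h)), map_sub]
  -- sum over the embeddings: the product formula at the totally split `p`
  have hsumδ : ∑ ι : K →+* ℚ_[p], padicLog p (ι (x₁ - x₂)) =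
      padicLog p ((Algebra.norm ℚ (x₁ - x₂) : ℚ) : ℚ_[p]) := by
    rw [← prod_embeddings_eq_norm hsplit,
      padicLog_prod p _ _ (fun ι _ => (map_ne_zero ι).mpr (sub_ne_zero.mpr hx))]
  have key : (∑ ι : K →+* ℚ_[p], padicLog p (W.padicSigmaEval p (-ι x₃ / ι y₃))) +
      ∑ ι : K →+* ℚ_[p], padicLog p (W.padicSigmaEval p (-ι x₄ / ι y₄)) =
        padicLog p ((Algebra.norm ℚ (x₁ - x₂) : ℚ) : ℚ_[p]) +
          2 * ∑ ι : K →+* ℚ_[p], padicLog p (W.padicSigmaEval p (-ι x₁ / ι y₁)) +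
          2 * ∑ ι : K →+* ℚ_[p], padicLog p (W.padicSigmaEval p (-ι x₂ / ι y₂)) := by
    rw [← Finset.sum_add_distrib, Finset.sum_congr rfl (fun ι _ => hlogσ ι), Finset.sum_add_distrib,
      Finset.sum_add_distrib, ← Finset.mul_sum, ← Finset.mul_sum, hsumδ]
  rw [hS, hD]
  simp only [canonicalPAdicHeightK_some]
  linear_combination hlogd - 2 * key

/-- **Existence of the canonical `p`-adic height over `K` from θ₁ (existence of the Mazur–Tate
pair, MST 2006 Thm. 1.3, `mazur_tate_sigma_existsUnique`) and θ₂ (the formal theta identity,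
Blakestad–Grant 2023 Prop. 14 / MT 1991 Thm. 3.1, `padicSigma_theta_formal`)** — the same two
named facts behind the `ℚ`-version `exists_isCanonical` (`exists_isCanonical_of_MT_theta`): for
`W`, `W ⊗ K` globally minimal, `p ≥ 5` good ordinary and totally split in `K`, the sigma formula
`ĥ_{p,K}` is, on admissible points, the quadratic form of a symmetric bilinear torsion-vanishing
pairing on `E(K)`. Proof as for `ℚ` (MST 2006 §1, §2.6–2.8): the admissible locus with `O` is a
subgroup (`exists_addSubgroup_coe_eq_localConditionsLocusK`), torsion-free because `E₁` at an
embedding is (`not_isOfFinAddOrder_of_one_lt_norm_emb`; an embedding exists since there are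
`[K:ℚ] ≥ 1` of them), the generic parallelogram law
(`canonicalPAdicHeightK_parallelogram_of_MT_theta`) upgrades to the full one
(`parallelogram_of_generic`) and Jordan–von Neumann plus injectivity of `ℚ_p` give the pairing
(`exists_pairing_of_parallelogram`). [Mazur–Stein–Tate 2006, §2.6–2.8; Balakrishnan–Çiperiani–Stein
2015, §4.1 eq. (4.1); Perrin-Riou 1987, §1.2] [cite: MazurSteinTate2006, §2.8] -/
theorem exists_isCanonicalK_of_MT_theta (hMT : mazur_tate_sigma_existsUnique)
    (hθ : padicSigma_theta_formal) : exists_isCanonicalK := by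
  intro W _ _ K _ _ _ p _ hp hgood hord hsplit
  have hp2 : p ≠ 2 := by omega
  haveI : (W.baseChange K).IsElliptic := by rw [baseChange]; infer_instance
  obtain ⟨H, hH⟩ := exists_addSubgroup_coe_eq_localConditionsLocusK W K hp2
  have hmem : ∀ P, P ∈ H ↔ P = 0 ∨ W.SatisfiesLocalConditionsK p K P := fun P => by
    rw [← SetLike.mem_coe, hH]; rfl
  have hslc : ∀ P ∈ H, P ≠ 0 → W.SatisfiesLocalConditionsK p K P := fun P hP h0 =>
    ((hmem P).mp hP).resolve_left h0
  -- an embedding `K → ℚ_p` exists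
  have hne : Nonempty (K →+* ℚ_[p]) := by
    rw [← Fintype.card_pos_iff, hsplit]; exact Module.finrank_pos
  obtain ⟨ι₀⟩ := hne
  -- `H` is torsion-free
  have htf' : ∀ P ∈ H, IsOfFinAddOrder P → P = 0 := by
    intro P hP hfin
    by_contra h0
    have hP' := hslc P hP h0
    cases P with
    | zero => exact h0 rfl
    | some x y h => exact not_isOfFinAddOrder_of_one_lt_norm_emb (by omega) ι₀ h (hP'.1 ι₀).1 hfin
  -- the full parallelogram law on `H`
  have hfull := parallelogram_of_generic H htf' (W.canonicalPAdicHeightK p K) rfl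
    fun P hP Q hQ hP0 hQ0 hPQ hPQ' =>
      canonicalPAdicHeightK_parallelogram_of_MT_theta hMT hθ W K p hp hgood hord hsplit P Q
        (hslc P hP hP0) (hslc Q hQ hQ0) hPQ hPQ'
  obtain ⟨B, hsymm, htors, hdiag⟩ := exists_pairing_of_parallelogram H _ hfull
  exact ⟨⟨B, hsymm, fun P Q hP => htors P Q hP⟩, hsplit,
    fun P hP => hdiag P ((hmem P).mpr (Or.inr hP.2))⟩

/-- The same with uniqueness: with the tree's theorem `exists_admissibleK_nsmul_holds` (admissible
multiples over `K`) the canonical `K`-datum is unique (`PAdicHeightDataK.isCanonical_unique`).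
[Mazur–Stein–Tate 2006, §1 ("extends uniquely"); Perrin-Riou 1987, §1.2] [folklore] -/
theorem existsUnique_isCanonicalK_of_MT_theta (hMT : mazur_tate_sigma_existsUnique)
    (hθ : padicSigma_theta_formal) (W : WeierstrassCurve ℚ) [W.IsElliptic] [W.IsGloballyMinimal]
    (K : Type) [Field K] [NumberField K] [(W.baseChange K).IsGloballyMinimal] (p : ℕ) [Fact p.Prime]
    (hp : 5 ≤ p) (hgood : W.HasGoodReductionAtPrime p) (hord : ¬ (p : ℤ) ∣ W.frobeniusTrace p)
    (hsplit : Fintype.card (K →+* ℚ_[p]) = Module.finrank ℚ K) :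
    ∃! DK : PAdicHeightDataK W p K, DK.IsCanonical := by
  obtain ⟨DK, hDK⟩ := exists_isCanonicalK_of_MT_theta hMT hθ W K p hp hgood hord hsplit
  exact ⟨DK, hDK, fun D' hD' =>
    PAdicHeightDataK.isCanonical_unique (exists_admissibleK_nsmul_holds W K p) hD' hDK⟩

end WeierstrassCurve
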